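import Literature.NumberTheory.Transcendental.BakerQuantDelta
import HarnessLib

/-!
# Cijsouw–Waldschmidt 1977 over `ℚ` (`p = 2`): the parameters

Support file (plain definitions and theorems; no named fact) for the proof of Cijsouw–Waldschmidt
1977, Proposition 1 over `ℚ` with `p = 2`: the choice of the parameters of §4 (p. 183) and the
elementary inequalities between them.  With `m = d + 1` logarithms, `Ω = ∏ log Aᵢ`,
`W₀ = log B + log Ω`, `U = Ω log Ω · W₀` and a large integer `ν` we take (p. 183, with the block
length `R` of the `Δ`-polynomials divided by `log Ω`, all points of the finest level being integers)
`S₀ = ⌊ν² W₀⌋`, `T = ⌊ν^{2m+2} Ω log Ω⌋`, `R = ⌊ν W₀ / log Ω⌋ + 1`, `Lᵢ = ⌊ν^{2m} Ω log Ω / log Aᵢ⌋`,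
`R · L_b ≈ 3 ν^{2m+2} Ω W₀`, and `2^{J₀} ≤ T − 1 < 2^{J₀+1}`.

## References
* P. L. Cijsouw, M. Waldschmidt, *Linear forms and simultaneous approximations*, Compositio Math.
  34 (1977), 173–197, §4.
* A. Baker, *Transcendental Number Theory*, Cambridge University Press, 1975, Ch. 3 §2.
-/

noncomputable section

open Finset Real
open Literature.NumberTheory.Transcendental.Baker1975

namespace Literature.NumberTheory.Transcendental.CW77

/-- **The parameters** of the proof of Proposition 1 over `ℚ` (`p = 2`): `d + 1` "sizes"
`Eᵢ ≥ e` (bounds for the logarithmic heights and the logarithms), `B ≥ e` (a bound for the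
coefficients), and the large integer `ν`, subject to the single largeness condition `master`.
[cite: CijsouwWaldschmidt1977, §4 (p. 183)] -/
structure Par (d : ℕ) where
  /-- `Eᵢ = log Aᵢ` -/
  E : Fin (d + 1) → ℝ
  /-- the bound for the coefficients -/
  B : ℝ
  /-- the large integer `ν` -/
  ν : ℕ
  /-- `Eᵢ ≥ e` -/
  hE : ∀ i, Real.exp 1 ≤ E i
  /-- `B ≥ e` -/
  hB : Real.exp 1 ≤ B
  /-- the largeness of `ν` -/
  master : 1000000 * 4 ^ (d + 2) * (d + 2) * (1 + Real.log ν) ≤ (ν : ℝ)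

namespace Par

variable {d : ℕ} (P : Par d)

/-- `Ω = ∏ Eᵢ`. [cite: CijsouwWaldschmidt1977, Theorem 1] -/
def Ω : ℝ := ∏ i, P.E i

/-- `log Ω`. [folklore] -/
def lΩ : ℝ := Real.log P.Ω

/-- `W₀ = log B + log Ω`. [cite: CijsouwWaldschmidt1977, Theorem 1] -/
def W₀ : ℝ := Real.log P.B + P.lΩ

/-- `X = Ω log Ω`. [folklore] -/
def X : ℝ := P.Ω * P.lΩ

/-- `U = Ω log Ω (log B + log Ω)`. [cite: CijsouwWaldschmidt1977, §4 (p. 183)] -/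
def U : ℝ := P.X * P.W₀

/-- The error unit `𝔘 = ν^{2m+3} U` (`m = d + 1`). [cite: CijsouwWaldschmidt1977, §4] -/
def Uν : ℝ := (P.ν : ℝ) ^ (2 * d + 5) * P.U

/-- `S₀ = ⌊ν² W₀⌋` (the number of points at level `0`). [cite: CijsouwWaldschmidt1977, §4 (p. 183)] -/
def S₀ : ℕ := ⌊(P.ν : ℝ) ^ 2 * P.W₀⌋₊

/-- `T = ⌊ν^{2m+2} Ω log Ω⌋` (the order of vanishing at level `0`). [cite: CijsouwWaldschmidt1977, §4 (p. 183)] -/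
def T : ℕ := ⌊(P.ν : ℝ) ^ (2 * d + 4) * P.X⌋₊

/-- `R = ⌊ν W₀ / log Ω⌋ + 1` (the block length of the `Δ`-polynomials). [cite: CijsouwWaldschmidt1977, §4 (p. 183)] -/
def R : ℕ := ⌊(P.ν : ℝ) * P.W₀ / P.lΩ⌋₊ + 1

/-- `L_b = ⌊3 ν^{2m+2} Ω W₀ / R⌋ + 1` (the number of blocks). [cite: CijsouwWaldschmidt1977, §4 (p. 183)] -/
def Lb : ℕ := ⌊3 * (P.ν : ℝ) ^ (2 * d + 4) * P.Ω * P.W₀ / P.R⌋₊ + 1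

/-- `Lᵢ = ⌊ν^{2m} Ω log Ω / Eᵢ⌋`. [cite: CijsouwWaldschmidt1977, §4 (p. 183)] -/
def Lf (i : Fin (d + 1)) : ℕ := ⌊(P.ν : ℝ) ^ (2 * d + 2) * P.X / P.E i⌋₊

/-- The `Lⱼ` of the free logarithms. [folklore] -/
def L : Fin d → ℕ := fun j => P.Lf (Fin.castSucc j)

/-- `L_θ`, for the eliminated logarithm. [folklore] -/
def Lθ : ℕ := P.Lf (Fin.last d)

/-- The number of `2`-descent steps: `2^{J₀} ≤ T − 1 < 2^{J₀+1}`. [cite: CijsouwWaldschmidt1977, §4 Step 3 (p. 191)] -/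
def J₀ : ℕ := Nat.log 2 (P.T - 1)

/-- The exponent `β = 100 (m+1)(1 + log ν)` of the common bound `𝔅 = exp(β 𝔘)`. [folklore] -/
def β : ℝ := 100 * (d + 2) * (1 + Real.log P.ν)

/-- The common bound `𝔅 = exp(β 𝔘)` for all the quantities of size `exp(O(ν^{2m+3} U))`. [folklore] -/
def 𝔅 : ℝ := Real.exp (P.β * P.Uν)

/-! ### Elementary inequalities -/

/-- `ν ≥ 10⁶`. [folklore] -/
theorem nu_ge : (1000000 : ℝ) ≤ P.ν := by
  have h := P.master
  have h4 : (16 : ℝ) ≤ 4 ^ (d + 2) := by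
    calc (16 : ℝ) = 4 ^ 2 := by norm_num
      _ ≤ 4 ^ (d + 2) := pow_le_pow_right₀ (by norm_num) (by omega)
  have hd : (2 : ℝ) ≤ d + 2 := by
    have : (0 : ℝ) ≤ d := by positivity
    linarith
  have hν1 : (1 : ℝ) ≤ P.ν := by
    by_contra hlt
    have hlt := not_le.mp hlt
    have hν0 : (P.ν : ℝ) = 0 := by
      have : P.ν < 1 := by exact_mod_cast hlt
      simp [Nat.lt_one_iff.mp this]
    have : 0 < 1000000 * 4 ^ (d + 2) * (d + 2 : ℝ) * (1 + Real.log P.ν) := by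
      rw [hν0, Real.log_zero, add_zero, mul_one]; positivity
    linarith
  have hlog : 0 ≤ Real.log P.ν := Real.log_nonneg hν1
  have : 1000000 * 16 * 2 * 1 ≤ 1000000 * 4 ^ (d + 2) * (d + 2 : ℝ) * (1 + Real.log P.ν) := by
    have h1 : (1 : ℝ) ≤ 1 + Real.log P.ν := by linarith
    calc (1000000 * 16 * 2 * 1 : ℝ) ≤ 1000000 * 4 ^ (d + 2) * 2 * 1 := by nlinarith
      _ ≤ 1000000 * 4 ^ (d + 2) * (d + 2 : ℝ) * 1 := by
          apply mul_le_mul_of_nonneg_right _ zero_le_one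
          exact mul_le_mul_of_nonneg_left hd (by positivity)
      _ ≤ 1000000 * 4 ^ (d + 2) * (d + 2 : ℝ) * (1 + Real.log P.ν) :=
          mul_le_mul_of_nonneg_left h1 (by positivity)
  linarith

/-- `ν ≥ 100` (a convenient weak form). [folklore] -/
theorem nu_ge_100 : (100 : ℝ) ≤ P.ν := le_trans (by norm_num) P.nu_ge

/-- `ν ≥ 2` as naturals. [folklore] -/
theorem two_le_nu : 2 ≤ P.ν := by
  have := P.nu_ge_100
  exact_mod_cast (show (2 : ℝ) ≤ P.ν by linarith)

/-- `0 < ν`. [folklore] -/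
theorem nu_pos : (0 : ℝ) < P.ν := by linarith [P.nu_ge_100]

/-- `1 ≤ ν`. [folklore] -/
theorem one_le_nu : (1 : ℝ) ≤ P.ν := by linarith [P.nu_ge_100]

/-- `log ν ≥ 4`. [folklore] -/
theorem four_le_log_nu : (4 : ℝ) ≤ Real.log P.ν := by
  rw [Real.le_log_iff_exp_le P.nu_pos]
  have h1 : Real.exp 1 < 3 := Real.exp_one_lt_d9.trans (by norm_num)
  have : Real.exp 4 = Real.exp 1 ^ 4 := by rw [Real.exp_one_pow]; norm_num
  rw [this]
  have h0 : 0 < Real.exp 1 := Real.exp_pos 1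
  nlinarith [P.nu_ge_100, pow_le_pow_left₀ h0.le h1.le 4]

/-- `0 ≤ log ν`. [folklore] -/
theorem log_nu_nonneg : 0 ≤ Real.log P.ν := by linarith [P.four_le_log_nu]

/-- **The master inequality, convenient form**: `(m+1)(1 + log ν) · 10⁶ · 4^{m+1} ≤ ν`. [folklore] -/
theorem master' : 1000000 * 4 ^ (d + 2) * ((d + 2 : ℝ) * (1 + Real.log P.ν)) ≤ P.ν := by
  have := P.master; linarith [this]

/-- `(d+2)(1 + log ν) ≤ ν / 10⁶`. [folklore] -/
theorem dlog_le : 1000000 * ((d + 2 : ℝ) * (1 + Real.log P.ν)) ≤ P.ν := by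
  have h := P.master'
  have h4 : (1 : ℝ) ≤ 4 ^ (d + 2) := one_le_pow₀ (by norm_num)
  have h0 : (0 : ℝ) ≤ (d + 2 : ℝ) * (1 + Real.log P.ν) := by
    have := P.log_nu_nonneg; positivity
  nlinarith

/-- `E i > 0`. [folklore] -/
theorem E_pos (i : Fin (d + 1)) : 0 < P.E i := lt_of_lt_of_le (Real.exp_pos 1) (P.hE i)

/-- `1 ≤ E i`. [folklore] -/
theorem one_le_E (i : Fin (d + 1)) : 1 ≤ P.E i :=
  le_trans (by linarith [Real.exp_one_gt_two]) (P.hE i)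

/-- `Ω ≥ e^{d+1}`. [folklore] -/
theorem exp_pow_le_Ω : Real.exp 1 ^ (d + 1) ≤ P.Ω := by
  unfold Ω
  calc Real.exp 1 ^ (d + 1) = ∏ _i : Fin (d + 1), Real.exp 1 := by simp
    _ ≤ ∏ i, P.E i := prod_le_prod (fun i _ => (Real.exp_pos 1).le) fun i _ => P.hE i

/-- `Ω ≥ e`. [folklore] -/
theorem exp_le_Ω : Real.exp 1 ≤ P.Ω := by
  refine le_trans ?_ P.exp_pow_le_Ω
  calc Real.exp 1 = Real.exp 1 ^ 1 := (pow_one _).symm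
    _ ≤ Real.exp 1 ^ (d + 1) := pow_le_pow_right₀ (by linarith [Real.exp_one_gt_two]) (by omega)

/-- `Ω > 0`. [folklore] -/
theorem Ω_pos : 0 < P.Ω := lt_of_lt_of_le (Real.exp_pos 1) P.exp_le_Ω

/-- `1 ≤ Ω`. [folklore] -/
theorem one_le_Ω : 1 ≤ P.Ω := le_trans (by linarith [Real.exp_one_gt_two]) P.exp_le_Ω

/-- `Eᵢ ≤ Ω`. [folklore] -/
theorem E_le_Ω (i : Fin (d + 1)) : P.E i ≤ P.Ω := by
  unfold Ω
  calc P.E i = ∏ k, (if k = i then P.E i else 1) := by rw [prod_ite_eq']; simp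
    _ ≤ ∏ k, P.E k := by
        refine prod_le_prod (fun k _ => ?_) fun k _ => ?_
        · split_ifs <;> first | exact (P.E_pos i).le | exact zero_le_one
        · split_ifs with hk
          · rw [hk]
          · exact P.one_le_E k

/-- `∑ Eᵢ ≤ (d+1) Ω`. [folklore] -/
theorem sum_E_le : ∑ i, P.E i ≤ (d + 1) * P.Ω := by
  calc ∑ i, P.E i ≤ ∑ _i : Fin (d + 1), P.Ω := sum_le_sum fun i _ => P.E_le_Ω i
    _ = (d + 1) * P.Ω := by simp

/-- `log Ω ≥ d + 1 ≥ 1`. [folklore] -/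
theorem lΩ_ge : (d + 1 : ℝ) ≤ P.lΩ := by
  unfold lΩ
  rw [Real.le_log_iff_exp_le P.Ω_pos]
  calc Real.exp (d + 1 : ℝ) = Real.exp 1 ^ (d + 1) := by
        rw [Real.exp_one_pow]; norm_cast
    _ ≤ P.Ω := P.exp_pow_le_Ω

/-- `1 ≤ log Ω`. [folklore] -/
theorem one_le_lΩ : 1 ≤ P.lΩ :=
  le_trans (by have h := Nat.cast_nonneg (α := ℝ) d; linarith) P.lΩ_ge

/-- `0 < log Ω`. [folklore] -/
theorem lΩ_pos : 0 < P.lΩ := by linarith [P.one_le_lΩ]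

/-- `log Ω ≤ Ω`. [folklore] -/
theorem lΩ_le_Ω : P.lΩ ≤ P.Ω := by
  unfold lΩ; linarith [Real.log_le_sub_one_of_pos P.Ω_pos]

/-- `log log Ω ≤ log Ω`, so `log X ≤ 2 log Ω`. [folklore] -/
theorem log_X_le : Real.log P.X ≤ 2 * P.lΩ := by
  unfold X
  rw [Real.log_mul P.Ω_pos.ne' P.lΩ_pos.ne']
  have : Real.log P.lΩ ≤ P.lΩ := by linarith [Real.log_le_sub_one_of_pos P.lΩ_pos]
  unfold lΩ at this ⊢; linarith

/-- `1 ≤ log B`. [folklore] -/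
theorem one_le_logB : 1 ≤ Real.log P.B := by
  rw [Real.le_log_iff_exp_le (lt_of_lt_of_le (Real.exp_pos 1) P.hB)]
  exact P.hB

/-- `W₀ ≥ 2`. [folklore] -/
theorem two_le_W₀ : 2 ≤ P.W₀ := by unfold W₀; linarith [P.one_le_logB, P.one_le_lΩ]

/-- `0 < W₀`. [folklore] -/
theorem W₀_pos : 0 < P.W₀ := by linarith [P.two_le_W₀]

/-- `log Ω ≤ W₀`. [folklore] -/
theorem lΩ_le_W₀ : P.lΩ ≤ P.W₀ := by unfold W₀; linarith [P.one_le_logB]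

/-- `log B ≤ W₀ - 1`. [folklore] -/
theorem logB_le : Real.log P.B ≤ P.W₀ - 1 := by unfold W₀; linarith [P.one_le_lΩ]

/-- `log W₀ ≤ W₀`. [folklore] -/
theorem log_W₀_le : Real.log P.W₀ ≤ P.W₀ := by linarith [Real.log_le_sub_one_of_pos P.W₀_pos]

/-- `X ≥ Ω`. [folklore] -/
theorem Ω_le_X : P.Ω ≤ P.X := by
  unfold X
  have := P.one_le_lΩ; have := P.Ω_pos
  nlinarith

/-- `X ≥ e ≥ 2`. [folklore] -/
theorem two_le_X : 2 ≤ P.X := le_trans (by linarith [Real.exp_one_gt_two, P.exp_le_Ω]) P.Ω_le_X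

/-- `0 < X`. [folklore] -/
theorem X_pos : 0 < P.X := by linarith [P.two_le_X]

/-- `U = X W₀ ≥ 2 X`. [folklore] -/
theorem two_X_le_U : 2 * P.X ≤ P.U := by
  unfold U; have := P.two_le_W₀; have := P.X_pos; nlinarith

/-- `X ≤ U`. [folklore] -/
theorem X_le_U : P.X ≤ P.U := by linarith [P.two_X_le_U, P.X_pos]

/-- `0 < U`. [folklore] -/
theorem U_pos : 0 < P.U := by linarith [P.X_le_U, P.X_pos]

/-- `4 ≤ U`. [folklore] -/
theorem four_le_U : 4 ≤ P.U := by linarith [P.two_X_le_U, P.two_le_X]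

/-- `Ω W₀ ≤ U` (as `log Ω ≥ 1`). [folklore] -/
theorem ΩW₀_le_U : P.Ω * P.W₀ ≤ P.U := by
  unfold U X
  have := P.one_le_lΩ; have := P.Ω_pos; have := P.W₀_pos
  nlinarith [mul_nonneg P.Ω_pos.le P.W₀_pos.le]

/-- `X log Ω ≤ U` (as `log Ω ≤ W₀`). [folklore] -/
theorem XlΩ_le_U : P.X * P.lΩ ≤ P.U := by
  unfold U; exact mul_le_mul_of_nonneg_left P.lΩ_le_W₀ P.X_pos.le

/-- `W₀ ≤ U`. [folklore] -/
theorem W₀_le_U : P.W₀ ≤ P.U := by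
  unfold U; have := P.two_le_X; have := P.W₀_pos; nlinarith

/-- Powers of `ν` are `≥ 1`. [folklore] -/
theorem one_le_nu_pow (k : ℕ) : (1 : ℝ) ≤ (P.ν : ℝ) ^ k := one_le_pow₀ P.one_le_nu

/-- Powers of `ν` are monotone. [folklore] -/
theorem nu_pow_le_pow {a b : ℕ} (h : a ≤ b) : (P.ν : ℝ) ^ a ≤ (P.ν : ℝ) ^ b :=
  pow_le_pow_right₀ P.one_le_nu h

/-- `0 < 𝔘`. [folklore] -/
theorem Uν_pos : 0 < P.Uν := by unfold Uν; exact mul_pos (pow_pos P.nu_pos _) P.U_pos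

/-- `U ≤ 𝔘`. [folklore] -/
theorem U_le_Uν : P.U ≤ P.Uν := by
  unfold Uν
  have := P.one_le_nu_pow (2 * d + 5); have := P.U_pos
  nlinarith

/-- `4 ≤ 𝔘`. [folklore] -/
theorem four_le_Uν : 4 ≤ P.Uν := P.four_le_U.trans P.U_le_Uν

/-- `ν^{2m+2} X ≤ 𝔘 / (2ν)`, i.e. `2 ν · ν^{2d+4} X ≤ 𝔘`. [folklore] -/
theorem nuT_le : 2 * (P.ν : ℝ) * ((P.ν : ℝ) ^ (2 * d + 4) * P.X) ≤ P.Uν := by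
  unfold Uν
  have h := P.two_X_le_U
  have hp : (0 : ℝ) ≤ (P.ν : ℝ) ^ (2 * d + 4) := by positivity
  calc 2 * (P.ν : ℝ) * ((P.ν : ℝ) ^ (2 * d + 4) * P.X) = (P.ν : ℝ) ^ (2 * d + 5) * (2 * P.X) := by ring
    _ ≤ (P.ν : ℝ) ^ (2 * d + 5) * P.U := mul_le_mul_of_nonneg_left h (by positivity)

/-- `ν² ν^{2d+4} = ν · ν^{2d+5}` bookkeeping: `ν^{2d+4} X · ν² W₀ = ν 𝔘`. [folklore] -/
theorem TS₀_real : (P.ν : ℝ) ^ (2 * d + 4) * P.X * ((P.ν : ℝ) ^ 2 * P.W₀) = P.ν * P.Uν := by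
  unfold Uν U; ring

/-! ### The integer parameters -/

/-- `S₀ ≤ ν² W₀`. [folklore] -/
theorem S₀_le : (P.S₀ : ℝ) ≤ (P.ν : ℝ) ^ 2 * P.W₀ :=
  Nat.floor_le (by have := P.W₀_pos; positivity)

/-- `ν² W₀ - 1 ≤ S₀`. [folklore] -/
theorem S₀_ge : (P.ν : ℝ) ^ 2 * P.W₀ - 1 ≤ P.S₀ := by
  have := Nat.lt_floor_add_one ((P.ν : ℝ) ^ 2 * P.W₀)
  unfold S₀; linarith

/-- `ν² W₀ ≥ 20000`. [folklore] -/
theorem nu_sq_W₀_ge : (20000 : ℝ) ≤ (P.ν : ℝ) ^ 2 * P.W₀ := by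
  have h1 : (10000 : ℝ) ≤ (P.ν : ℝ) ^ 2 := by nlinarith [P.nu_ge_100]
  nlinarith [P.two_le_W₀]

/-- `2 ≤ S₀`. [folklore] -/
theorem two_le_S₀ : 2 ≤ P.S₀ := by
  have := P.S₀_ge; have := P.nu_sq_W₀_ge
  exact_mod_cast (show (2 : ℝ) ≤ P.S₀ by linarith)

/-- `S₀ ≥ ν² W₀ / 2`. [folklore] -/
theorem S₀_ge' : (P.ν : ℝ) ^ 2 * P.W₀ / 2 ≤ P.S₀ := by
  have := P.S₀_ge; have := P.nu_sq_W₀_ge; linarith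

/-- `T ≤ ν^{2d+4} X`. [folklore] -/
theorem T_le : (P.T : ℝ) ≤ (P.ν : ℝ) ^ (2 * d + 4) * P.X :=
  Nat.floor_le (by have := P.X_pos; positivity)

/-- `ν^{2d+4} X - 1 ≤ T`. [folklore] -/
theorem T_ge : (P.ν : ℝ) ^ (2 * d + 4) * P.X - 1 ≤ P.T := by
  have := Nat.lt_floor_add_one ((P.ν : ℝ) ^ (2 * d + 4) * P.X)
  unfold T; linarith

/-- `ν^{2d+4} X ≥ 2 · 10⁸`. [folklore] -/
theorem nuX_ge : (200000000 : ℝ) ≤ (P.ν : ℝ) ^ (2 * d + 4) * P.X := by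
  have h1 : (100000000 : ℝ) ≤ (P.ν : ℝ) ^ (2 * d + 4) := by
    calc (100000000 : ℝ) = 100 ^ 4 := by norm_num
      _ ≤ (P.ν : ℝ) ^ 4 := pow_le_pow_left₀ (by norm_num) P.nu_ge_100 4
      _ ≤ (P.ν : ℝ) ^ (2 * d + 4) := P.nu_pow_le_pow (by omega)
  nlinarith [P.two_le_X]

/-- `3 ≤ T`. [folklore] -/
theorem three_le_T : 3 ≤ P.T := by
  have := P.T_ge; have := P.nuX_ge
  exact_mod_cast (show (3 : ℝ) ≤ P.T by linarith)

/-- `T ≥ ν^{2d+4} X / 2`. [folklore] -/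
theorem T_ge' : (P.ν : ℝ) ^ (2 * d + 4) * P.X / 2 ≤ P.T := by
  have := P.T_ge; have := P.nuX_ge; linarith

/-- `0 < T`. [folklore] -/
theorem T_pos : (0 : ℝ) < P.T := by have := P.three_le_T; exact_mod_cast (show 0 < P.T by omega)

/-- `T ≤ 𝔘 / (2ν)`. [folklore] -/
theorem T_le' : 2 * (P.ν : ℝ) * P.T ≤ P.Uν :=
  le_trans (mul_le_mul_of_nonneg_left P.T_le (by linarith [P.nu_pos])) P.nuT_le

/-- `T ≤ 𝔘`. [folklore] -/
theorem T_le_Uν : (P.T : ℝ) ≤ P.Uν := by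
  have := P.T_le'; have := P.nu_ge_100; have := P.T_pos; nlinarith

/-- `T W₀ ≤ 𝔘 / ν`. [folklore] -/
theorem TW₀_le : (P.ν : ℝ) * (P.T * P.W₀) ≤ P.Uν := by
  calc (P.ν : ℝ) * (P.T * P.W₀) ≤ P.ν * ((P.ν : ℝ) ^ (2 * d + 4) * P.X * P.W₀) :=
        mul_le_mul_of_nonneg_left (mul_le_mul_of_nonneg_right P.T_le P.W₀_pos.le) P.nu_pos.le
    _ = P.Uν := by unfold Uν U; ring

/-- `T log Ω ≤ 𝔘 / ν`. [folklore] -/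
theorem TlΩ_le : (P.ν : ℝ) * (P.T * P.lΩ) ≤ P.Uν := by
  calc (P.ν : ℝ) * (P.T * P.lΩ) ≤ P.ν * (P.T * P.W₀) :=
        mul_le_mul_of_nonneg_left (mul_le_mul_of_nonneg_left P.lΩ_le_W₀ P.T_pos.le) P.nu_pos.le
    _ ≤ P.Uν := P.TW₀_le

/-- `S₀ ≤ 𝔘 / ν` (crude). [folklore] -/
theorem S₀_le' : (P.ν : ℝ) * P.S₀ ≤ P.Uν := by
  calc (P.ν : ℝ) * P.S₀ ≤ P.ν * ((P.ν : ℝ) ^ 2 * P.W₀) := mul_le_mul_of_nonneg_left P.S₀_le P.nu_pos.le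
    _ = (P.ν : ℝ) ^ 3 * 1 * P.W₀ := by ring
    _ ≤ (P.ν : ℝ) ^ (2 * d + 5) * P.X * P.W₀ := by
        apply mul_le_mul_of_nonneg_right _ P.W₀_pos.le
        exact mul_le_mul (P.nu_pow_le_pow (by omega)) (by linarith [P.two_le_X]) zero_le_one (by positivity)
    _ = P.Uν := by unfold Uν U; ring

/-- `T S₀ ≤ ν 𝔘`. [folklore] -/
theorem TS₀_le : (P.T : ℝ) * P.S₀ ≤ P.ν * P.Uν := by
  rw [← P.TS₀_real]
  exact mul_le_mul P.T_le P.S₀_le (by positivity) (by have := P.X_pos; positivity)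

/-- `T S₀ ≥ ν 𝔘 / 4`. [folklore] -/
theorem TS₀_ge : (P.ν : ℝ) * P.Uν / 4 ≤ (P.T : ℝ) * P.S₀ := by
  rw [← P.TS₀_real]
  have h1 := P.T_ge'; have h2 := P.S₀_ge'
  have h3 : (0 : ℝ) ≤ (P.ν : ℝ) ^ (2 * d + 4) * P.X / 2 := by have := P.X_pos; positivity
  have h4 : (0 : ℝ) ≤ (P.ν : ℝ) ^ 2 * P.W₀ / 2 := by have := P.W₀_pos; positivity
  calc (P.ν : ℝ) ^ (2 * d + 4) * P.X * ((P.ν : ℝ) ^ 2 * P.W₀) / 4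
      = ((P.ν : ℝ) ^ (2 * d + 4) * P.X / 2) * ((P.ν : ℝ) ^ 2 * P.W₀ / 2) := by ring
    _ ≤ (P.T : ℝ) * P.S₀ := mul_le_mul h1 h2 h4 (h3.trans h1)

/-- `R ≤ ν W₀ / log Ω + 1`. [folklore] -/
theorem R_le : (P.R : ℝ) ≤ P.ν * P.W₀ / P.lΩ + 1 := by
  unfold R; push_cast
  have := Nat.floor_le (show (0 : ℝ) ≤ P.ν * P.W₀ / P.lΩ by
    have := P.W₀_pos; have := P.lΩ_pos; have := P.nu_pos; positivity)
  linarith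

/-- `ν W₀ / log Ω ≤ R`. [folklore] -/
theorem R_ge : (P.ν : ℝ) * P.W₀ / P.lΩ ≤ P.R := by
  unfold R; push_cast
  exact (Nat.lt_floor_add_one _).le

/-- `ν ≤ ν W₀ / log Ω`. [folklore] -/
theorem nu_le_ratio : (P.ν : ℝ) ≤ P.ν * P.W₀ / P.lΩ := by
  rw [le_div_iff₀ P.lΩ_pos]
  exact mul_le_mul_of_nonneg_left P.lΩ_le_W₀ P.nu_pos.le

/-- `ν ≤ R`, in particular `2 ≤ R`. [folklore] -/
theorem nu_le_R : (P.ν : ℝ) ≤ P.R := P.nu_le_ratio.trans P.R_ge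

/-- `2 ≤ R`. [folklore] -/
theorem two_le_R : 2 ≤ P.R := by
  have := P.nu_le_R; have := P.nu_ge_100
  exact_mod_cast (show (2 : ℝ) ≤ P.R by linarith)

/-- `0 < R`. [folklore] -/
theorem R_pos : (0 : ℝ) < P.R := by have := P.two_le_R; exact_mod_cast (show 0 < P.R by omega)

/-- `R ≤ 2 ν W₀ / log Ω`. [folklore] -/
theorem R_le' : (P.R : ℝ) ≤ 2 * (P.ν * P.W₀ / P.lΩ) := by
  have := P.R_le; have := P.nu_le_ratio; have := P.nu_ge_100; linarith

/-- `R log Ω ≤ ν W₀ + log Ω ≤ 2 ν W₀`. [folklore] -/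
theorem RlΩ_le : (P.R : ℝ) * P.lΩ ≤ P.ν * P.W₀ + P.lΩ := by
  have h := mul_le_mul_of_nonneg_right P.R_le P.lΩ_pos.le
  rwa [add_mul, one_mul, div_mul_cancel₀ _ P.lΩ_pos.ne'] at h

/-- `R T ≤ 𝔘 + 𝔘/(2ν)`: precisely `R T ≤ ν^{2d+5} X W₀ / log Ω + ν^{2d+4} X ≤ (1 + 1/(2ν)) 𝔘`. [folklore] -/
theorem RT_le : (P.R : ℝ) * P.T ≤ P.Uν + P.Uν / (2 * P.ν) := by
  have h1 : (P.R : ℝ) * P.T ≤ (P.ν * P.W₀ / P.lΩ + 1) * ((P.ν : ℝ) ^ (2 * d + 4) * P.X) :=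
    mul_le_mul P.R_le P.T_le P.T_pos.le (by have := P.R_pos; have := P.R_le; linarith)
  have h2 : P.ν * P.W₀ / P.lΩ * ((P.ν : ℝ) ^ (2 * d + 4) * P.X) = (P.ν : ℝ) ^ (2 * d + 5) * P.Ω * P.W₀ := by
    unfold X; field_simp [P.lΩ_pos.ne']; ring
  have h3 : (P.ν : ℝ) ^ (2 * d + 5) * P.Ω * P.W₀ ≤ P.Uν := by
    unfold Uν; rw [mul_assoc]; exact mul_le_mul_of_nonneg_left P.ΩW₀_le_U (by positivity)
  have h4 : (P.ν : ℝ) ^ (2 * d + 4) * P.X ≤ P.Uν / (2 * P.ν) := by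
    rw [le_div_iff₀ (by linarith [P.nu_pos])]
    have := P.nuT_le; linarith
  calc (P.R : ℝ) * P.T ≤ (P.ν * P.W₀ / P.lΩ + 1) * ((P.ν : ℝ) ^ (2 * d + 4) * P.X) := h1
    _ = P.ν * P.W₀ / P.lΩ * ((P.ν : ℝ) ^ (2 * d + 4) * P.X) + (P.ν : ℝ) ^ (2 * d + 4) * P.X := by ring
    _ ≤ P.Uν + P.Uν / (2 * P.ν) := by rw [h2]; exact add_le_add h3 h4

/-- `R T log Ω ≤ 𝔘 + 𝔘/ν`. [folklore] -/
theorem RTlΩ_le : (P.R : ℝ) * P.T * P.lΩ ≤ P.Uν + P.Uν / P.ν := by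
  have h1 : (P.R : ℝ) * P.T * P.lΩ ≤ (P.ν * P.W₀ + P.lΩ) * ((P.ν : ℝ) ^ (2 * d + 4) * P.X) := by
    calc (P.R : ℝ) * P.T * P.lΩ = (P.R * P.lΩ) * P.T := by ring
      _ ≤ (P.ν * P.W₀ + P.lΩ) * ((P.ν : ℝ) ^ (2 * d + 4) * P.X) :=
          mul_le_mul P.RlΩ_le P.T_le P.T_pos.le (by have := P.nu_pos; have := P.W₀_pos; have := P.lΩ_pos; positivity)
  have h2 : P.ν * P.W₀ * ((P.ν : ℝ) ^ (2 * d + 4) * P.X) = P.Uν := by unfold Uν U; ring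
  have h3 : P.lΩ * ((P.ν : ℝ) ^ (2 * d + 4) * P.X) ≤ P.Uν / P.ν := by
    rw [le_div_iff₀ P.nu_pos]
    calc P.lΩ * ((P.ν : ℝ) ^ (2 * d + 4) * P.X) * P.ν = (P.ν : ℝ) ^ (2 * d + 5) * (P.X * P.lΩ) := by ring
      _ ≤ (P.ν : ℝ) ^ (2 * d + 5) * P.U := mul_le_mul_of_nonneg_left P.XlΩ_le_U (by positivity)
      _ = P.Uν := rfl
  calc (P.R : ℝ) * P.T * P.lΩ ≤ (P.ν * P.W₀ + P.lΩ) * ((P.ν : ℝ) ^ (2 * d + 4) * P.X) := h1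
    _ = P.ν * P.W₀ * ((P.ν : ℝ) ^ (2 * d + 4) * P.X) + P.lΩ * ((P.ν : ℝ) ^ (2 * d + 4) * P.X) := by ring
    _ ≤ P.Uν + P.Uν / P.ν := by rw [h2]; exact add_le_add le_rfl h3

/-- `3 ν^{2d+4} Ω W₀ ≤ R L_b`. [folklore] -/
theorem RLb_ge : 3 * (P.ν : ℝ) ^ (2 * d + 4) * P.Ω * P.W₀ ≤ (P.R : ℝ) * P.Lb := by
  have h1 : 3 * (P.ν : ℝ) ^ (2 * d + 4) * P.Ω * P.W₀ / P.R ≤ P.Lb := by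
    unfold Lb; push_cast; exact (Nat.lt_floor_add_one _).le
  rw [div_le_iff₀ P.R_pos] at h1; linarith

/-- `R L_b ≤ 3 ν^{2d+4} Ω W₀ + R`. [folklore] -/
theorem RLb_le : (P.R : ℝ) * P.Lb ≤ 3 * (P.ν : ℝ) ^ (2 * d + 4) * P.Ω * P.W₀ + P.R := by
  have h1 : (P.Lb : ℝ) ≤ 3 * (P.ν : ℝ) ^ (2 * d + 4) * P.Ω * P.W₀ / P.R + 1 := by
    unfold Lb; push_cast
    have := Nat.floor_le (show (0 : ℝ) ≤ 3 * (P.ν : ℝ) ^ (2 * d + 4) * P.Ω * P.W₀ / P.R by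
      have := P.W₀_pos; have := P.Ω_pos; have := P.R_pos; positivity)
    linarith
  have h2 := mul_le_mul_of_nonneg_left h1 P.R_pos.le
  rwa [mul_add, mul_one, mul_div_cancel₀ _ P.R_pos.ne'] at h2

/-- `3 ν^{2d+4} Ω W₀ ≤ 3 𝔘 / ν`. [folklore] -/
theorem nuΩW₀_le : (P.ν : ℝ) * (3 * (P.ν : ℝ) ^ (2 * d + 4) * P.Ω * P.W₀) ≤ 3 * P.Uν := by
  calc (P.ν : ℝ) * (3 * (P.ν : ℝ) ^ (2 * d + 4) * P.Ω * P.W₀) = 3 * ((P.ν : ℝ) ^ (2 * d + 5) * (P.Ω * P.W₀)) := by ring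
    _ ≤ 3 * ((P.ν : ℝ) ^ (2 * d + 5) * P.U) := by
        refine mul_le_mul_of_nonneg_left (mul_le_mul_of_nonneg_left P.ΩW₀_le_U (by positivity)) (by norm_num)
    _ = 3 * P.Uν := rfl

/-- `R ≤ 𝔘 / ν` (crude). [folklore] -/
theorem R_le_Uν : (P.ν : ℝ) * P.R ≤ P.Uν := by
  have h1 : (P.R : ℝ) ≤ P.ν * P.W₀ + 1 := by
    have := P.R_le
    have h2 : P.ν * P.W₀ / P.lΩ ≤ P.ν * P.W₀ := div_le_self (by have := P.nu_pos; have := P.W₀_pos; positivity) P.one_le_lΩ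
    linarith
  calc (P.ν : ℝ) * P.R ≤ P.ν * (P.ν * P.W₀ + 1) := mul_le_mul_of_nonneg_left h1 P.nu_pos.le
    _ ≤ P.ν * (P.ν * P.W₀ + P.ν * P.W₀) := by
        apply mul_le_mul_of_nonneg_left _ P.nu_pos.le
        have := P.nu_ge_100; have := P.two_le_W₀; nlinarith
    _ = (P.ν : ℝ) ^ 2 * 1 * (2 * P.W₀) := by ring
    _ ≤ (P.ν : ℝ) ^ (2 * d + 5) * P.X * P.W₀ := by
        have h3 : 2 * P.W₀ ≤ P.X * P.W₀ := mul_le_mul_of_nonneg_right P.two_le_X P.W₀_pos.le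
        calc (P.ν : ℝ) ^ 2 * 1 * (2 * P.W₀) ≤ (P.ν : ℝ) ^ (2 * d + 5) * 1 * (2 * P.W₀) := by
              apply mul_le_mul_of_nonneg_right _ (by linarith [P.W₀_pos])
              exact mul_le_mul_of_nonneg_right (P.nu_pow_le_pow (by omega)) zero_le_one
          _ ≤ (P.ν : ℝ) ^ (2 * d + 5) * 1 * (P.X * P.W₀) := mul_le_mul_of_nonneg_left h3 (by positivity)
          _ = (P.ν : ℝ) ^ (2 * d + 5) * P.X * P.W₀ := by ring
    _ = P.Uν := by unfold Uν U; ring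

/-- `R L_b ≤ 4 𝔘 / ν`. [folklore] -/
theorem RLb_le' : (P.ν : ℝ) * (P.R * P.Lb) ≤ 4 * P.Uν := by
  have := mul_le_mul_of_nonneg_left P.RLb_le P.nu_pos.le
  have := P.nuΩW₀_le; have := P.R_le_Uν
  nlinarith

/-- `L_i ≤ ν^{2d+2} X / E_i`. [folklore] -/
theorem Lf_le (i : Fin (d + 1)) : (P.Lf i : ℝ) ≤ (P.ν : ℝ) ^ (2 * d + 2) * P.X / P.E i :=
  Nat.floor_le (by have := P.X_pos; have := P.E_pos i; positivity)

/-- `L_i E_i ≤ ν^{2d+2} X`. [folklore] -/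
theorem Lf_mul_E_le (i : Fin (d + 1)) : (P.Lf i : ℝ) * P.E i ≤ (P.ν : ℝ) ^ (2 * d + 2) * P.X := by
  have := mul_le_mul_of_nonneg_right (P.Lf_le i) (P.E_pos i).le
  rwa [div_mul_cancel₀ _ (P.E_pos i).ne'] at this

/-- `∑ L_i E_i ≤ (d+1) ν^{2d+2} X`. [folklore] -/
theorem sum_Lf_E_le : ∑ i, (P.Lf i : ℝ) * P.E i ≤ (d + 1) * ((P.ν : ℝ) ^ (2 * d + 2) * P.X) := by
  calc ∑ i, (P.Lf i : ℝ) * P.E i ≤ ∑ _i : Fin (d + 1), (P.ν : ℝ) ^ (2 * d + 2) * P.X :=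
        sum_le_sum fun i _ => P.Lf_mul_E_le i
    _ = (d + 1) * ((P.ν : ℝ) ^ (2 * d + 2) * P.X) := by simp

/-- `S₀ ∑ L_i E_i ≤ (d+1) 𝔘 / ν`. [folklore] -/
theorem S₀_sum_Lf_E_le : (P.ν : ℝ) * (P.S₀ * ∑ i, (P.Lf i : ℝ) * P.E i) ≤ (d + 1) * P.Uν := by
  have h1 : (P.S₀ : ℝ) * ∑ i, (P.Lf i : ℝ) * P.E i ≤ ((P.ν : ℝ) ^ 2 * P.W₀) * ((d + 1) * ((P.ν : ℝ) ^ (2 * d + 2) * P.X)) :=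
    mul_le_mul P.S₀_le P.sum_Lf_E_le (sum_nonneg fun i _ => by have := P.E_pos i; positivity)
      (by have := P.W₀_pos; positivity)
  calc (P.ν : ℝ) * (P.S₀ * ∑ i, (P.Lf i : ℝ) * P.E i)
      ≤ P.ν * (((P.ν : ℝ) ^ 2 * P.W₀) * ((d + 1) * ((P.ν : ℝ) ^ (2 * d + 2) * P.X))) :=
        mul_le_mul_of_nonneg_left h1 P.nu_pos.le
    _ = (d + 1) * P.Uν := by unfold Uν U; ring

/-- `L_i ≤ ν^{2d+2} X / e ≤ ν^{2d+2} X / 2`. [folklore] -/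
theorem Lf_le' (i : Fin (d + 1)) : (P.Lf i : ℝ) ≤ (P.ν : ℝ) ^ (2 * d + 2) * P.X / 2 := by
  refine (P.Lf_le i).trans ?_
  exact div_le_div_of_nonneg_left (by have := P.X_pos; positivity) (by norm_num)
    (le_trans Real.exp_one_gt_two.le (P.hE i))

/-- `ν^{2d+2} X / E_i ≤ L_i + 1`. [folklore] -/
theorem Lf_succ_ge (i : Fin (d + 1)) : (P.ν : ℝ) ^ (2 * d + 2) * P.X / P.E i ≤ P.Lf i + 1 := by
  unfold Lf; exact (Nat.lt_floor_add_one _).le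

/-- `L_i S₀ ≤ 𝔘 / ν` (crude, for the smallness parameter `x`). [folklore] -/
theorem LfS₀_le (i : Fin (d + 1)) : (P.ν : ℝ) * (P.Lf i * P.S₀) ≤ P.Uν := by
  have h1 : (P.Lf i : ℝ) * P.S₀ ≤ ((P.ν : ℝ) ^ (2 * d + 2) * P.X / 2) * ((P.ν : ℝ) ^ 2 * P.W₀) :=
    mul_le_mul (P.Lf_le' i) P.S₀_le (by positivity) (by have := P.X_pos; positivity)
  calc (P.ν : ℝ) * (P.Lf i * P.S₀) ≤ P.ν * (((P.ν : ℝ) ^ (2 * d + 2) * P.X / 2) * ((P.ν : ℝ) ^ 2 * P.W₀)) :=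
        mul_le_mul_of_nonneg_left h1 P.nu_pos.le
    _ = P.Uν / 2 := by unfold Uν U; ring
    _ ≤ P.Uν := by linarith [P.Uν_pos]

/-! ### The dyadic depth `J₀` -/

/-- `2^{J₀} ≤ T - 1`. [folklore] -/
theorem two_pow_J₀_le : 2 ^ P.J₀ ≤ P.T - 1 :=
  Nat.pow_log_le_self 2 (by have := P.three_le_T; omega)

/-- `T - 1 < 2^{J₀+1}`. [folklore] -/
theorem lt_two_pow_J₀_succ : P.T - 1 < 2 ^ (P.J₀ + 1) :=
  Nat.lt_pow_succ_log_self (by norm_num) _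

/-- `T ≤ 2^{J₀+1}`. [folklore] -/
theorem T_le_two_pow : P.T ≤ 2 ^ (P.J₀ + 1) := by have := P.lt_two_pow_J₀_succ; omega

/-- `1 ≤ J₀` (as `T ≥ 3`). [folklore] -/
theorem one_le_J₀ : 1 ≤ P.J₀ := by
  by_contra h0
  have h : P.J₀ = 0 := by omega
  have := P.lt_two_pow_J₀_succ
  rw [h] at this
  have := P.three_le_T; omega

/-- `1 ≤ T / 2^{J₀}`. [folklore] -/
theorem one_le_T_div : 1 ≤ P.T / 2 ^ P.J₀ := by
  rw [Nat.le_div_iff_mul_le (Nat.pow_pos two_pos)]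
  have := P.two_pow_J₀_le; omega

/-- `1 ≤ T / 2^J` for `J ≤ J₀`. [folklore] -/
theorem one_le_T_div_of_le {J : ℕ} (hJ : J ≤ P.J₀) : 1 ≤ P.T / 2 ^ J := by
  refine le_trans P.one_le_T_div (Nat.div_le_div_left ?_ (Nat.pow_pos two_pos))
  exact Nat.pow_le_pow_right two_pos hJ

/-- `L_i < 2^{J₀}`. [folklore] -/
theorem Lf_lt_two_pow (i : Fin (d + 1)) : P.Lf i < 2 ^ P.J₀ := by
  have h1 := P.Lf_le' i
  have h2 : ((P.T : ℕ) : ℝ) ≤ ((2 ^ (P.J₀ + 1) : ℕ) : ℝ) := by exact_mod_cast P.T_le_two_pow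
  push_cast at h2
  rw [pow_succ] at h2
  have h3 := P.T_ge
  have h4 : (100 : ℝ) ≤ (P.ν : ℝ) ^ 2 := by nlinarith [P.nu_ge_100]
  have hX := P.X_pos
  have h5 : (P.ν : ℝ) ^ (2 * d + 4) * P.X = (P.ν : ℝ) ^ 2 * ((P.ν : ℝ) ^ (2 * d + 2) * P.X) := by ring
  set Y := (P.ν : ℝ) ^ (2 * d + 2) * P.X with hY
  have h6 : (2 : ℝ) ≤ Y := by
    rw [hY]; nlinarith [P.one_le_nu_pow (2 * d + 2), P.two_le_X]
  have h7 : 100 * Y ≤ (P.ν : ℝ) ^ 2 * Y := mul_le_mul_of_nonneg_right h4 (by linarith)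
  rw [h5] at h3
  have : (P.Lf i : ℝ) < (2 : ℝ) ^ P.J₀ := by linarith
  exact_mod_cast this

/-- `R L_b ≤ 2^{J₀} S₀ / 2` (the count of Step 3). [cite: CijsouwWaldschmidt1977, §4 Step 3 (p. 191)] -/
theorem RLb_le_count : P.R * P.Lb ≤ 2 ^ P.J₀ * P.S₀ / 2 := by
  rw [Nat.le_div_iff_mul_le two_pos]
  have h2 : ((P.T : ℕ) : ℝ) ≤ ((2 ^ (P.J₀ + 1) : ℕ) : ℝ) := by exact_mod_cast P.T_le_two_pow
  push_cast at h2
  rw [pow_succ] at h2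
  have hRLb := P.RLb_le
  have hR : (P.R : ℝ) ≤ P.ν * P.W₀ + 1 := by
    have := P.R_le
    have : P.ν * P.W₀ / P.lΩ ≤ P.ν * P.W₀ :=
      div_le_self (by have := P.nu_pos; have := P.W₀_pos; positivity) P.one_le_lΩ
    linarith
  have hT := P.T_ge'; have hS := P.S₀_ge'
  have hν := P.nu_ge_100; have hW := P.two_le_W₀; have hΩX := P.Ω_le_X
  have hΩ1 := P.one_le_Ω
  set Z := (P.ν : ℝ) ^ (2 * d + 4) * P.Ω * P.W₀ with hZ
  have hnp : (P.ν : ℝ) ≤ (P.ν : ℝ) ^ (2 * d + 4) := by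
    calc (P.ν : ℝ) = (P.ν : ℝ) ^ 1 := (pow_one _).symm
      _ ≤ _ := P.nu_pow_le_pow (by omega)
  have hZ1 : (P.ν : ℝ) * P.W₀ ≤ Z := by
    rw [hZ]
    calc (P.ν : ℝ) * P.W₀ = (P.ν : ℝ) * 1 * P.W₀ := by ring
      _ ≤ (P.ν : ℝ) ^ (2 * d + 4) * P.Ω * P.W₀ := by
          apply mul_le_mul_of_nonneg_right _ (by linarith)
          exact mul_le_mul hnp hΩ1 zero_le_one (by positivity)
  have hZ2 : (2 : ℝ) ≤ Z := by nlinarith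
  have hlhs : 2 * ((P.R : ℝ) * P.Lb) ≤ 9 * Z := by nlinarith
  -- the right-hand side
  have hJ : (P.ν : ℝ) ^ (2 * d + 4) * P.Ω / 4 ≤ (2 : ℝ) ^ P.J₀ := by
    have : (P.ν : ℝ) ^ (2 * d + 4) * P.Ω ≤ (P.ν : ℝ) ^ (2 * d + 4) * P.X :=
      mul_le_mul_of_nonneg_left hΩX (by positivity)
    linarith
  have hS' : 5000 * P.W₀ ≤ (P.S₀ : ℝ) := by
    have : (10000 : ℝ) ≤ (P.ν : ℝ) ^ 2 := by nlinarith
    nlinarith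
  have hrhs : 1250 * Z ≤ (2 : ℝ) ^ P.J₀ * P.S₀ := by
    have h0 : (0 : ℝ) ≤ (P.ν : ℝ) ^ (2 * d + 4) * P.Ω / 4 := by positivity
    calc 1250 * Z = ((P.ν : ℝ) ^ (2 * d + 4) * P.Ω / 4) * (5000 * P.W₀) := by rw [hZ]; ring
      _ ≤ (2 : ℝ) ^ P.J₀ * P.S₀ := mul_le_mul hJ hS' (by linarith) (h0.trans hJ)
  have key : 2 * ((P.R : ℝ) * P.Lb) ≤ (2 : ℝ) ^ P.J₀ * P.S₀ := by nlinarith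
  exact_mod_cast (show ((P.R * P.Lb * 2 : ℕ) : ℝ) ≤ ((2 ^ P.J₀ * P.S₀ : ℕ) : ℝ) by push_cast; linarith)

/-! ### The common bound `𝔅 = exp(β 𝔘)` -/

/-- `200 ≤ β`. [folklore] -/
theorem β_ge : 200 ≤ P.β := by
  unfold β
  have h1 : (2 : ℝ) ≤ d + 2 := by have := Nat.cast_nonneg (α := ℝ) d; linarith
  have h2 : (1 : ℝ) ≤ 1 + Real.log P.ν := by linarith [P.log_nu_nonneg]
  nlinarith

/-- `0 < β`. [folklore] -/
theorem β_pos : 0 < P.β := by linarith [P.β_ge]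

/-- `β 𝔘 ≥ 800`. [folklore] -/
theorem βU_ge : 800 ≤ P.β * P.Uν := by nlinarith [P.β_ge, P.four_le_Uν]

/-- `𝔘 ≤ β 𝔘 / 200`. [folklore] -/
theorem Uν_le_βU : 200 * P.Uν ≤ P.β * P.Uν := mul_le_mul_of_nonneg_right P.β_ge P.Uν_pos.le

/-- `exp y ≤ 𝔅` when `y ≤ β 𝔘`. [folklore] -/
theorem exp_le_𝔅 {y : ℝ} (hy : y ≤ P.β * P.Uν) : Real.exp y ≤ P.𝔅 := Real.exp_le_exp.mpr hy

/-- `y ≤ 𝔅` when `log y ≤ β 𝔘`. [folklore] -/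
theorem le_𝔅_of_log_le {y : ℝ} (hy : Real.log y ≤ P.β * P.Uν) : y ≤ P.𝔅 := by
  rcases le_or_gt y 0 with h0 | h0
  · exact h0.trans (Real.exp_pos _).le
  · rw [← Real.exp_log h0]; exact P.exp_le_𝔅 hy

/-- `2 ≤ 𝔅`. [folklore] -/
theorem two_le_𝔅 : 2 ≤ P.𝔅 := by
  unfold 𝔅
  have h1 : (2 : ℝ) ≤ Real.exp 1 := Real.exp_one_gt_two.le
  exact h1.trans (Real.exp_le_exp.mpr (by linarith [P.βU_ge]))

/-- `1 ≤ 𝔅`. [folklore] -/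
theorem one_le_𝔅 : 1 ≤ P.𝔅 := by linarith [P.two_le_𝔅]

/-- `0 < 𝔅`. [folklore] -/
theorem 𝔅_pos : 0 < P.𝔅 := Real.exp_pos _

/-- `𝔅^k = exp(k β 𝔘)`. [folklore] -/
theorem 𝔅_pow (k : ℕ) : P.𝔅 ^ k = Real.exp (k * (P.β * P.Uν)) := by
  unfold 𝔅; rw [← Real.exp_nat_mul]

/-- A product of two quantities `≤ 𝔅` is `≤ 𝔅²`, etc.: `y₁ ≤ 𝔅^a`, `y₂ ≤ 𝔅^b`, `0 ≤ y₁` give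
`y₁ y₂ ≤ 𝔅^{a+b}`. [folklore] -/
theorem mul_le_𝔅_pow {y₁ y₂ : ℝ} {a b : ℕ} (h1 : y₁ ≤ P.𝔅 ^ a) (h2 : y₂ ≤ P.𝔅 ^ b) (h0 : 0 ≤ y₂) :
    y₁ * y₂ ≤ P.𝔅 ^ (a + b) := by
  rw [pow_add]; exact mul_le_mul h1 h2 h0 (by have := P.𝔅_pos; positivity)

/-- `c · 𝔘/ν ≤ 𝔘` whenever `c ≤ ν`; here in the form used below: if `ν y ≤ c 𝔘` and `c ≤ ν`
then `y ≤ 𝔘`. [folklore] -/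
theorem le_Uν_of {y c : ℝ} (h : P.ν * y ≤ c * P.Uν) (hc : c ≤ P.ν) : y ≤ P.Uν := by
  have hν := P.nu_pos; have hU := P.Uν_pos
  by_contra hlt
  have hlt := not_le.mp hlt
  have : c * P.Uν ≤ P.ν * P.Uν := mul_le_mul_of_nonneg_right hc hU.le
  nlinarith

/-- `(d + 2)(1 + log ν) · 1000 ≤ ν` (room for the lower-order terms). [folklore] -/
theorem dlog_le' : 1000 * ((d + 2 : ℝ) * (1 + Real.log P.ν)) ≤ P.ν := by
  have := P.dlog_le
  have h0 : (0 : ℝ) ≤ (d + 2 : ℝ) * (1 + Real.log P.ν) := by have := P.log_nu_nonneg; positivity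
  linarith

/-- `(d + 5) log ν ≤ ν / 100` and the like: `k ≤ 100 (d+2)` gives `k (1 + log ν) ≤ ν / 10`. [folklore] -/
theorem klog_le {k : ℝ} (hk : k ≤ 100 * (d + 2)) : 10 * (k * (1 + Real.log P.ν)) ≤ P.ν := by
  have h := P.dlog_le'
  have h1 : (0 : ℝ) ≤ 1 + Real.log P.ν := by linarith [P.log_nu_nonneg]
  nlinarith [mul_le_mul_of_nonneg_right hk h1]

/-! ### Logarithms of the parameters -/

/-- `log T ≤ (2d+4) log ν + 2 log Ω`. [folklore] -/
theorem log_T_le : Real.log P.T ≤ (2 * d + 4) * Real.log P.ν + 2 * P.lΩ := by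
  have h1 : Real.log P.T ≤ Real.log ((P.ν : ℝ) ^ (2 * d + 4) * P.X) := Real.log_le_log P.T_pos P.T_le
  rw [Real.log_mul (by have := P.nu_pos; positivity) P.X_pos.ne', Real.log_pow] at h1
  push_cast at h1
  linarith [P.log_X_le]

/-- `log S₀ ≤ 2 log ν + W₀`. [folklore] -/
theorem log_S₀_le : Real.log P.S₀ ≤ 2 * Real.log P.ν + P.W₀ := by
  have hS : (0 : ℝ) < P.S₀ := by have := P.two_le_S₀; exact_mod_cast (show 0 < P.S₀ by omega)
  have h1 : Real.log P.S₀ ≤ Real.log ((P.ν : ℝ) ^ 2 * P.W₀) := Real.log_le_log hS P.S₀_le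
  rw [Real.log_mul (by have := P.nu_pos; positivity) P.W₀_pos.ne', Real.log_pow] at h1
  push_cast at h1
  linarith [P.log_W₀_le]

/-- `log (T S₀) ≤ (2d+6) log ν + 3 W₀`. [folklore] -/
theorem log_TS₀_le : Real.log ((P.T : ℝ) * P.S₀) ≤ (2 * d + 6) * Real.log P.ν + 3 * P.W₀ := by
  have hS : (0 : ℝ) < P.S₀ := by have := P.two_le_S₀; exact_mod_cast (show 0 < P.S₀ by omega)
  rw [Real.log_mul P.T_pos.ne' hS.ne']
  linarith [P.log_T_le, P.log_S₀_le, P.lΩ_le_W₀]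

/-- `log 𝔘 ≤ 𝔘` and `log(T S₀) ≤ 𝔘`-type crude bounds: `(2d+6) log ν + 3 W₀ ≤ 𝔘 / ν`. [folklore] -/
theorem logTS₀_small : (P.ν : ℝ) * ((2 * d + 6) * Real.log P.ν + 3 * P.W₀) ≤ P.Uν := by
  -- ν (2d+6) log ν ≤ ν² ≤ 𝔘/2 and 3 ν W₀ ≤ 𝔘/2
  have hν := P.nu_ge_100; have hl := P.log_nu_nonneg
  have h1 : (2 * d + 6 : ℝ) * Real.log P.ν ≤ P.ν / 10 := by
    have := P.klog_le (k := 2 * d + 6) (by have := Nat.cast_nonneg (α := ℝ) d; linarith)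
    nlinarith
  have h2 : (P.ν : ℝ) * (P.ν / 10) ≤ P.Uν / 2 := by
    unfold Uν
    have : (P.ν : ℝ) ^ 2 ≤ (P.ν : ℝ) ^ (2 * d + 5) := P.nu_pow_le_pow (by omega)
    nlinarith [P.four_le_U, P.one_le_nu_pow (2 * d + 5)]
  have h3 : (P.ν : ℝ) * (3 * P.W₀) ≤ P.Uν / 2 := by
    unfold Uν U
    have hp : (P.ν : ℝ) ≤ (P.ν : ℝ) ^ (2 * d + 5) := by
      calc (P.ν : ℝ) = (P.ν : ℝ) ^ 1 := (pow_one _).symm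
        _ ≤ _ := P.nu_pow_le_pow (by omega)
    have hX := P.two_le_X; have hW := P.W₀_pos
    have hp2 : (P.ν : ℝ) * P.ν ≤ (P.ν : ℝ) ^ (2 * d + 5) := by
      calc (P.ν : ℝ) * P.ν = (P.ν : ℝ) ^ 2 := (sq _).symm
        _ ≤ _ := P.nu_pow_le_pow (by omega)
    have h4 : (P.ν : ℝ) * P.ν * (P.X * P.W₀) ≤ (P.ν : ℝ) ^ (2 * d + 5) * (P.X * P.W₀) :=
      mul_le_mul_of_nonneg_right hp2 (by positivity)
    have h5 : (P.ν : ℝ) * (3 * P.W₀) ≤ (P.ν : ℝ) * P.ν * (P.X * P.W₀) / 2 := by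
      have : 3 * P.W₀ ≤ P.ν * (P.X * P.W₀) / 2 := by
        have h6 : (6 : ℝ) * P.W₀ ≤ P.ν * P.X * P.W₀ := by
          apply mul_le_mul_of_nonneg_right _ hW.le
          nlinarith
        nlinarith
      have := mul_le_mul_of_nonneg_left this (le_of_lt (lt_of_lt_of_le (by norm_num) hν))
      linarith [this]
    linarith
  nlinarith

/-- `log 𝔘 ≤ 𝔘 / ν + (2d+5) log ν`… in the crude form `log 𝔘 ≤ 2 𝔘 / ν`. [folklore] -/
theorem log_Uν_le : (P.ν : ℝ) * Real.log P.Uν ≤ 2 * P.Uν := by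
  unfold Uν
  rw [Real.log_mul (by have := P.nu_pos; positivity) P.U_pos.ne', Real.log_pow]
  have hU : Real.log P.U ≤ 3 * P.W₀ := by
    unfold U
    rw [Real.log_mul P.X_pos.ne' P.W₀_pos.ne']
    linarith [P.log_X_le, P.log_W₀_le, P.lΩ_le_W₀]
  have h1 := P.logTS₀_small
  have hl := P.log_nu_nonneg; have hν := P.nu_pos
  have h2 : (P.ν : ℝ) * (((2 * d + 5 : ℕ) : ℝ) * Real.log P.ν + Real.log P.U) ≤
      P.ν * ((2 * d + 6) * Real.log P.ν + 3 * P.W₀) := by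
    apply mul_le_mul_of_nonneg_left _ hν.le
    push_cast; nlinarith
  have h3 := P.Uν_pos
  unfold Uν at *
  linarith

/-! ### The ratio `(x + R)/R` for points `x ≤ c T S₀` -/

/-- `T S₀ / R ≤ ν^{2d+5} Ω (log Ω)²`. [folklore] -/
theorem TS₀_div_R_le : (P.T : ℝ) * P.S₀ / P.R ≤ (P.ν : ℝ) ^ (2 * d + 5) * P.Ω * P.lΩ ^ 2 := by
  rw [div_le_iff₀ P.R_pos]
  have h1 : (P.T : ℝ) * P.S₀ ≤ (P.ν : ℝ) ^ (2 * d + 4) * P.X * ((P.ν : ℝ) ^ 2 * P.W₀) :=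
    mul_le_mul P.T_le P.S₀_le (by positivity) (by have := P.X_pos; positivity)
  have h2 := P.R_ge
  rw [div_le_iff₀ P.lΩ_pos] at h2
  have h3 : (P.ν : ℝ) ^ (2 * d + 4) * P.X * ((P.ν : ℝ) ^ 2 * P.W₀) =
      ((P.ν : ℝ) ^ (2 * d + 5) * P.Ω * P.lΩ ^ 2) * (P.ν * P.W₀ / P.lΩ) := by
    unfold X; field_simp; ring
  have h4 : (0 : ℝ) ≤ (P.ν : ℝ) ^ (2 * d + 5) * P.Ω * P.lΩ ^ 2 := by
    have := P.Ω_pos; positivity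
  calc (P.T : ℝ) * P.S₀ ≤ ((P.ν : ℝ) ^ (2 * d + 5) * P.Ω * P.lΩ ^ 2) * (P.ν * P.W₀ / P.lΩ) := by rw [← h3]; exact h1
    _ ≤ ((P.ν : ℝ) ^ (2 * d + 5) * P.Ω * P.lΩ ^ 2) * P.R := mul_le_mul_of_nonneg_left P.R_ge h4

/-- `1 ≤ ν^{2d+5} Ω (log Ω)²`. [folklore] -/
theorem one_le_nuΩlΩ : (1 : ℝ) ≤ (P.ν : ℝ) ^ (2 * d + 5) * P.Ω * P.lΩ ^ 2 := by
  have h1 := P.one_le_nu_pow (2 * d + 5); have h2 := P.one_le_Ω; have h3 := P.one_le_lΩ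
  have h4 : (1 : ℝ) ≤ P.lΩ ^ 2 := one_le_pow₀ h3
  exact one_le_mul_of_one_le_of_one_le (one_le_mul_of_one_le_of_one_le h1 h2) h4

/-- **`(x + R)/R ≤ (c + 1) ν^{2d+5} Ω (log Ω)²`** for `x ≤ c T S₀`. [folklore] -/
theorem ratio_le {x c : ℕ} (hx : x ≤ c * (P.T * P.S₀)) :
    ((x : ℝ) + P.R) / P.R ≤ (c + 1) * ((P.ν : ℝ) ^ (2 * d + 5) * P.Ω * P.lΩ ^ 2) := by
  have hR := P.R_pos
  have h1 : ((x : ℝ) + P.R) / P.R = x / P.R + 1 := by field_simp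
  rw [h1]
  have h2 : (x : ℝ) / P.R ≤ c * ((P.T : ℝ) * P.S₀ / P.R) := by
    rw [mul_div_assoc', div_le_div_iff_of_pos_right hR]
    exact_mod_cast hx
  have h3 := P.TS₀_div_R_le
  have h4 := P.one_le_nuΩlΩ
  have hc : (0 : ℝ) ≤ c := Nat.cast_nonneg c
  nlinarith [mul_le_mul_of_nonneg_left h3 hc]

/-- **`log((x + R)/R) ≤ log(c+1) + (2d+5) log ν + 3 log Ω`** for `x ≤ c T S₀`. [folklore] -/
theorem log_ratio_le {x c : ℕ} (hx : x ≤ c * (P.T * P.S₀)) :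
    Real.log (((x : ℝ) + P.R) / P.R) ≤ Real.log (c + 1) + (2 * d + 5) * Real.log P.ν + 3 * P.lΩ := by
  have hR := P.R_pos
  have hpos : 0 < ((x : ℝ) + P.R) / P.R := by positivity
  refine (Real.log_le_log hpos (P.ratio_le hx)).trans ?_
  have hc : (0 : ℝ) < c + 1 := by positivity
  have hne : (P.ν : ℝ) ^ (2 * d + 5) * P.Ω * P.lΩ ^ 2 ≠ 0 := by linarith [P.one_le_nuΩlΩ]
  have hne2 : (P.ν : ℝ) ^ (2 * d + 5) * P.Ω ≠ 0 := (mul_pos (pow_pos P.nu_pos _) P.Ω_pos).ne'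
  rw [Real.log_mul hc.ne' hne, Real.log_mul hne2 (pow_pos P.lΩ_pos 2).ne',
    Real.log_mul (pow_pos P.nu_pos _).ne' P.Ω_pos.ne', Real.log_pow, Real.log_pow]
  have : Real.log P.lΩ ≤ P.lΩ := by linarith [Real.log_le_sub_one_of_pos P.lΩ_pos]
  unfold lΩ at *
  push_cast
  nlinarith

/-- `0 ≤ log((x+R)/R)`. [folklore] -/
theorem log_ratio_nonneg (x : ℕ) : 0 ≤ Real.log (((x : ℝ) + P.R) / P.R) := by
  refine Real.log_nonneg ?_
  rw [le_div_iff₀ P.R_pos]; have := Nat.cast_nonneg (α := ℝ) x; linarith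

/-! ### The Schwarz-lemma exponent `kpts · t` -/

/-- `kpts = ⌊2^J S₀ / 2⌋ ≥ 2^J S₀ / 4`. [folklore] -/
theorem kpts_ge (J : ℕ) : (2 : ℝ) ^ J * P.S₀ / 4 ≤ ((2 ^ J * P.S₀ / 2 : ℕ) : ℝ) := by
  have hS := P.two_le_S₀
  have h1 : 2 ≤ 2 ^ J * P.S₀ := le_trans hS (Nat.le_mul_of_pos_left _ (Nat.pow_pos two_pos))
  have h2 : 2 ^ J * P.S₀ ≤ 2 * (2 ^ J * P.S₀ / 2) + 1 := by omega
  have h3 : ((2 ^ J * P.S₀ : ℕ) : ℝ) ≤ 2 * ((2 ^ J * P.S₀ / 2 : ℕ) : ℝ) + 1 := by exact_mod_cast h2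
  have h4 : (2 : ℝ) ≤ ((2 ^ J * P.S₀ : ℕ) : ℝ) := by exact_mod_cast h1
  push_cast at h3 h4
  linarith

/-- `kpts ≤ 2^J S₀ / 2`. [folklore] -/
theorem kpts_le (J : ℕ) : ((2 ^ J * P.S₀ / 2 : ℕ) : ℝ) ≤ (2 : ℝ) ^ J * P.S₀ / 2 := by
  have := Nat.cast_div_le (α := ℝ) (m := 2 ^ J * P.S₀) (n := 2)
  push_cast at this; exact this

/-- `t = T/2^J - T/2^{J+1} ≥ T / (4 · 2^J)` for `J < J₀`. [folklore] -/
theorem t_ge {J : ℕ} (hJ : J < P.J₀) :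
    (P.T : ℝ) / (4 * 2 ^ J) ≤ ((P.T / 2 ^ J - P.T / 2 ^ (J + 1) : ℕ) : ℝ) := by
  have h2J : 2 ^ (J + 1) ≤ P.T := by
    have h1 : 2 ^ (J + 1) ≤ 2 ^ P.J₀ := Nat.pow_le_pow_right two_pos hJ
    have := P.two_pow_J₀_le; omega
  set TJ := P.T / 2 ^ J with hTJ
  have hsub : 2 * (TJ - P.T / 2 ^ (J + 1)) ≥ TJ := by
    have : P.T / 2 ^ (J + 1) = TJ / 2 := by rw [hTJ, pow_succ, Nat.div_div_eq_div_mul]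
    rw [this]; omega
  have hTJge : 2 ^ J * TJ + 2 ^ J ≥ P.T + 1 := by
    have := Nat.lt_div_mul_add (a := P.T) (Nat.pow_pos two_pos (n := J))
    rw [← hTJ] at this
    have h5 : TJ * 2 ^ J = 2 ^ J * TJ := Nat.mul_comm _ _
    omega
  have hpow : (0 : ℝ) < 2 ^ J := by positivity
  have h6 : (2 : ℝ) ^ J * TJ + 2 ^ J ≥ P.T + 1 := by exact_mod_cast hTJge
  have h7 : (2 : ℝ) * ((TJ - P.T / 2 ^ (J + 1) : ℕ) : ℝ) ≥ TJ := by exact_mod_cast hsub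
  have h8 : ((2 ^ (J + 1) : ℕ) : ℝ) ≤ P.T := by exact_mod_cast h2J
  push_cast at h8
  rw [pow_succ] at h8
  rw [div_le_iff₀ (by positivity)]
  -- `T ≤ 2^J TJ + 2^J - 1` and `2^J ≤ T/2` give `2^J TJ ≥ T/2`, so `t ≥ TJ/2 ≥ T/(4·2^J)`
  nlinarith

/-- `t ≤ T / 2^J`. [folklore] -/
theorem t_le (J : ℕ) : ((P.T / 2 ^ J - P.T / 2 ^ (J + 1) : ℕ) : ℝ) ≤ (P.T : ℝ) / 2 ^ J := by
  calc ((P.T / 2 ^ J - P.T / 2 ^ (J + 1) : ℕ) : ℝ) ≤ ((P.T / 2 ^ J : ℕ) : ℝ) := by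
        exact_mod_cast Nat.sub_le _ _
    _ ≤ (P.T : ℝ) / 2 ^ J := by
        have := Nat.cast_div_le (α := ℝ) (m := P.T) (n := 2 ^ J)
        push_cast at this; exact this

/-- **`kpts · t ≥ ν 𝔘 / 64`** for `J < J₀`. [cite: CijsouwWaldschmidt1977, §4 Step 2 (p. 188)] -/
theorem kt_ge {J : ℕ} (hJ : J < P.J₀) :
    P.ν * P.Uν / 64 ≤ ((2 ^ J * P.S₀ / 2 : ℕ) : ℝ) * ((P.T / 2 ^ J - P.T / 2 ^ (J + 1) : ℕ) : ℝ) := by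
  have h1 := P.kpts_ge J; have h2 := P.t_ge hJ; have h3 := P.TS₀_ge
  have hpow : (0 : ℝ) < 2 ^ J := by positivity
  have h4 : (0 : ℝ) ≤ (2 : ℝ) ^ J * P.S₀ / 4 := by positivity
  have h5 : (0 : ℝ) ≤ (P.T : ℝ) / (4 * 2 ^ J) := by positivity
  calc P.ν * P.Uν / 64 ≤ (P.T : ℝ) * P.S₀ / 16 := by linarith
    _ = ((2 : ℝ) ^ J * P.S₀ / 4) * ((P.T : ℝ) / (4 * 2 ^ J)) := by field_simp; ring
    _ ≤ _ := mul_le_mul h1 h2 h5 (h4.trans h1)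

/-- **`kpts · t ≤ T S₀`**. [folklore] -/
theorem kt_le (J : ℕ) :
    ((2 ^ J * P.S₀ / 2 : ℕ) : ℝ) * ((P.T / 2 ^ J - P.T / 2 ^ (J + 1) : ℕ) : ℝ) ≤ (P.T : ℝ) * P.S₀ := by
  have h1 := P.kpts_le J; have h2 := P.t_le J
  have hpow : (0 : ℝ) < 2 ^ J := by positivity
  calc ((2 ^ J * P.S₀ / 2 : ℕ) : ℝ) * ((P.T / 2 ^ J - P.T / 2 ^ (J + 1) : ℕ) : ℝ)
      ≤ ((2 : ℝ) ^ J * P.S₀ / 2) * ((P.T : ℝ) / 2 ^ J) := mul_le_mul h1 h2 (by positivity) (by positivity)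
    _ = (P.T : ℝ) * P.S₀ / 2 := by field_simp
    _ ≤ (P.T : ℝ) * P.S₀ := by have := P.T_pos; have : (0:ℝ) ≤ P.S₀ := Nat.cast_nonneg _; nlinarith

/-- `kpts ≤ T S₀` and `t ≤ T` (crude). [folklore] -/
theorem kpts_le' {J : ℕ} (hJ : J < P.J₀) : ((2 ^ J * P.S₀ / 2 : ℕ) : ℝ) ≤ (P.T : ℝ) * P.S₀ := by
  refine (P.kpts_le J).trans ?_
  have h1 : (2 : ℝ) ^ J ≤ P.T := by
    have h2 : 2 ^ J ≤ P.T := by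
      have := Nat.pow_le_pow_right two_pos hJ.le; have := P.two_pow_J₀_le; omega
    exact_mod_cast h2
  have hS : (0 : ℝ) ≤ P.S₀ := Nat.cast_nonneg _
  have := P.T_pos
  nlinarith [mul_le_mul_of_nonneg_right h1 hS]

/-- `exp(1/2) ≤ 5/3`, so `(3/5)^n ≤ exp(−n/2)`. [folklore] -/
theorem three_fifths_pow_le (n : ℕ) : (3 / 5 : ℝ) ^ n ≤ Real.exp (-(n : ℝ) / 2) := by
  have h1 : Real.exp (1 / 2) ≤ 5 / 3 := by
    have h2 : Real.exp (1 / 2) ^ 2 = Real.exp 1 := by rw [← Real.exp_nat_mul]; norm_num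
    have h3 : Real.exp 1 < (5 / 3) ^ 2 := Real.exp_one_lt_d9.trans (by norm_num)
    nlinarith [Real.exp_pos (1 / 2 : ℝ)]
  have h4 : (3 / 5 : ℝ) ≤ Real.exp (-(1 / 2)) := by
    rw [Real.exp_neg, le_inv_comm₀ (by norm_num) (Real.exp_pos _)]
    linarith
  calc (3 / 5 : ℝ) ^ n ≤ Real.exp (-(1 / 2)) ^ n := pow_le_pow_left₀ (by norm_num) h4 n
    _ = Real.exp (-(n : ℝ) / 2) := by rw [← Real.exp_nat_mul]; ring_nf

/-- `28 e ≤ e⁵`, so `(28 e)^n ≤ exp(5 n)`. [folklore] -/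
theorem twentyeight_e_pow_le (n : ℕ) : (28 * Real.exp 1) ^ n ≤ Real.exp (5 * n) := by
  have h1 : 28 * Real.exp 1 ≤ Real.exp 5 := by
    have h2 : Real.exp 5 = Real.exp 1 ^ 4 * Real.exp 1 := by rw [← pow_succ, Real.exp_one_pow]; norm_num
    rw [h2]
    have h3 : (28 : ℝ) ≤ Real.exp 1 ^ 4 := by
      have := Real.exp_one_gt_two
      have h5 : (2.5 : ℝ) ≤ Real.exp 1 := by
        have := Real.exp_one_gt_d9; linarith
      calc (28 : ℝ) ≤ 2.5 ^ 4 := by norm_num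
        _ ≤ Real.exp 1 ^ 4 := pow_le_pow_left₀ (by norm_num) h5 4
    exact mul_le_mul_of_nonneg_right h3 (Real.exp_pos 1).le
  calc (28 * Real.exp 1) ^ n ≤ Real.exp 5 ^ n := pow_le_pow_left₀ (by positivity) h1 n
    _ = Real.exp (5 * n) := by rw [← Real.exp_nat_mul]; ring_nf

end Par

end Literature.NumberTheory.Transcendental.CW77

end
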